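import Literature.NumberTheory.ComplexMultiplication.CMOrderBassCyclicQuotient
import Literature.NumberTheory.ComplexMultiplication.CMOrderBassClifford
import Literature.NumberTheory.ComplexMultiplication.CMOrderOverorderPicardClasses
import HarnessLib

/-!
# Bass orders on the base carrier: `𝒪_K = S + Sω` ⟹ every over-order `M = MM` is Gorenstein (`Mᵗ` invertible in
# `M`, `M:(M:I) = I`), every fractional ideal is invertible in its own multiplicator ring (`I·((I:I):I) = (I:I)`),
# `ICM(S) = ⊔ Pic(M)` is Clifford (MARSEGLIA 2024 PROP. 4.6 (iv) ⟹ (ii), (iii); MARSEGLIA 2019 PROP. 3.7)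

Family `hodge`, lane `lit-hodgefound` (Track 2 foundations library; seat p15, row g29-#3), topic
`Literature/NumberTheory/ComplexMultiplication`, namespace `Literature.NumberTheory.ComplexMultiplication.CMTypeLattice`.
Sequel of g29-#2 `CMOrderBassCyclicQuotient`, which proved PROP. 4.6 (iv) ⟹ (i), (ii), (iii) for the over-orders
PRESENTED as rings `T = endOrder (M_ν) ⊇ S` (trace dual `Tᵗ` invertible in `FractionalIdeal T⁰ K`).  This file reads
those statements on the BASE CARRIER `FractionalIdeal S⁰ K` of the series (`CMOrderGorenstein`, `CMOrderBassClifford`,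
`CMOrderOverorderPicardClasses`): an over-order is an idempotent `N = NN ≠ 0`, its ideals are the `I` with `NI = I`,
its trace dual is the `TN` with `↑TN = traceDual ℤ ℚ ↑N`, «`N` Gorenstein» is `TN·B = N` / `N:(N:I) = I`, and «`S` is
Bass» has the three equivalent forms (a) every over-order reflexive, (b) `I·((I:I):I) = (I:I)` for all `I ≠ 0`,
(c) every `I ≠ 0` invertible in some over-order (Clifford) of `CMOrderBassClifford`.  «`𝒪_K/S` is cyclic» is
`↑M = Submodule.span S {1, ω}` for the maximal order `M` (`↑M = range (algebraMap (𝓞 K) K)`).  THEOREMS ONLY: no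
definition, no instance, no named fact (net Literature debt `0`).

## Sources, VERBATIM

S. Marseglia, *Cohen-Macaulay type of orders, generators and ideal classes*, J. Algebra 658 (2024) 247–276
[Marseglia2024CMType] (held `paper:arxiv-2206.03758`), §4 chunks p0010–p0011: "Proposition 4.6. Let `S` be a
non-maximal order. Then the following are equivalent: (i) For every overorder `T` of `S` we have `type(T) = 1`.
(ii) Every overorder of `S` is Gorenstein. (iii) Every fractional `S`-ideal `I` is invertible as a fractional
`(I:I)`-ideal. (iv) The `S`-module `𝒪_K/S` is cyclic. (v) `gens(S) = 2`."; §5 Corollary 5.6 (chunk p0013): "Assume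
that `S` is Bass. Then `W̄(S)` equals the set of overorders of `S` and `ICM(S) = ⊔_T Pic(T)`, where `T` runs over the
set of overorders of `S`."

S. Marseglia, *Computing the ideal class monoid of an order*, J. Lond. Math. Soc. (2) 101 (2020) [Marseglia2019], §3
Prop. 3.7, p. 6: "The following are equivalent: (a) `R` is Bass, (b) the inclusion in (3.1) [`ICM(R) ⊇ ⊔ Pic(S)`] is
an equality, (c) `ICM(R)` is Clifford."

J. A. Buchmann, H. W. Lenstra, Jr., *Approximating rings of integers in number fields*, J. Théor. Nombres Bordeaux 6
(1994) [BuchmannLenstra1994], §2 Prop. 2.7, p. 230: an order `A` is Gorenstein iff (a) `A : (A : a) = a` for all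
fractional ideals, iff (c) `A†` is invertible.

## What is formalised

* §1 (transport between a ring presentation `T = endOrder (M_ν)` of an over-order and the base carrier):
  **`exists_basis_mem_endOrder_iff_mem`** (every over-order `N = NN ≠ 0` of `S` IS an order `endOrder (M_ν) ⊇ S` with
  carrier `↑N`), `coe_eq_coe_of_coe_eq_traceDual` (trace duals depend only on the carrier),
  **`exists_traceDual_mul_eq_of_isUnit`** (`Tᵗ` invertible in `FractionalIdeal T⁰ K` ⟹ `TN·B = N` on the base carrier).
* §2 (PROP. 4.6 from (iv), base carrier): **`exists_traceDual_mul_eq_of_coe_eq_span_pair`** /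
  `traceDual_mul_div_eq_of_coe_eq_span_pair` («(ii) every overorder of `S` is Gorenstein»: `Nᵗ·(N:Nᵗ) = N`,
  PROP. 2.7 (c)), **`div_div_eq_of_coe_eq_span_pair`** (PROP. 2.7 (a): `N:(N:I) = I`), **`mul_div_self_div_eq_div_self_of_coe_eq_span_pair`
  («(iii) every fractional `S`-ideal `I` is invertible as a fractional `(I:I)`-ideal»: `I·((I:I):I) = (I:I)`)**,
  **`exists_idempotent_invertible_of_coe_eq_span_pair`** («`ICM(S) = ⊔_T Pic(T)`», Clifford),
  `isUnit_traceDual_one_of_coe_eq_span_pair` (`S` itself is Gorenstein: `Sᵗ` invertible) and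
  `isUnit_of_div_self_eq_one_of_coe_eq_span_pair` (every `I` with `(I:I) = S` is invertible).
-/

noncomputable section

open scoped nonZeroDivisors NumberField
open NumberField Module FractionalIdeal
open Submodule (traceDual)

namespace Literature.NumberTheory.ComplexMultiplication

namespace CMTypeLattice

/-! ## §1 Ring presentations of over-orders and the base carrier -/

section Transport

variable {K : Type} [Field K] [NumberField K]
variable {ι : Type} [Fintype ι] [DecidableEq ι] (μ : Basis ι ℚ K) [Nonempty ι]
variable [IsFractionRing (endOrder (Algebra.leftMulMatrix μ)) K]

/-- **Every over-order `N = NN ≠ 0` of `S = endOrder (M_μ)` is an order of the series: `↑N` is the carrier of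
`T = endOrder (M_ν) ⊇ S` for a `ℤ`-basis `ν` of `N`** (a lattice containing `1` and closed under products is its own
order). [cite: Marseglia2019, §2 Lemma 2.2 («`S` is an over-order of `R` if and only if `S` is a fractional `R`-ideal
with `SS = S`»), p. 4] [cite: Marseglia2024CMType, §4 Prop. 4.6 («every overorder `T` of `S`»), p. 10] -/
theorem exists_basis_mem_endOrder_iff_mem {M : FractionalIdeal (endOrder (Algebra.leftMulMatrix μ))⁰ K}
    (hMM : M * M = M) (hM0 : M ≠ 0) :
    ∃ ν : Basis ι ℚ K, (∀ x : K, x ∈ endOrder (Algebra.leftMulMatrix ν) ↔ x ∈ M) ∧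
      endOrder (Algebra.leftMulMatrix μ) ≤ endOrder (Algebra.leftMulMatrix ν) := by
  haveI := isNoetherianRing_endOrder (Algebra.leftMulMatrix μ)
  obtain ⟨ν, hν⟩ := exists_basis_span_eq_restrictScalars_coe μ hM0
  have h1 : (1 : K) ∈ M := EndOrder.one_mem_of_mul_self_eq hM0 hMM
  have hmem : ∀ x : K, x ∈ Submodule.span ℤ (Set.range ν) ↔ x ∈ M := fun x ↦ by
    rw [hν, Submodule.restrictScalars_mem, mem_coe]
  have hiff : ∀ x : K, x ∈ endOrder (Algebra.leftMulMatrix ν) ↔ x ∈ M := fun x ↦ by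
    rw [mem_endOrder_iff_of_one_mem_of_mul_mem ν ((hmem 1).2 h1) (fun a ha b hb ↦ by
      rw [hmem] at ha hb ⊢
      exact hMM.le (mul_mem_mul ha hb)) x, hmem]
  refine ⟨ν, hiff, fun s hs ↦ (hiff s).2 ?_⟩
  have h := (EndOrder.one_le_of_mul_self_eq hMM hM0) ((mem_one_iff _).2 ⟨⟨s, hs⟩, rfl⟩)
  exact h

omit [Nonempty ι] [IsFractionRing (endOrder (Algebra.leftMulMatrix μ)) K] in
/-- **Trace duals are computed on lattices**: if `↑I = ↑I′` for a fractional `S`-ideal `I` and a fractional `T`-ideal `I′`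
then their trace duals `T`, `T′` have the same carrier. [cite: Marseglia2019, §2 («`I^t = {x ∈ K : Tr(xI) ⊆ ℤ}`»),
p. 4] [cite: BuchmannLenstra1994, §2.3 («the complementary module `A†`»), p. 228] -/
theorem coe_eq_coe_of_coe_eq_traceDual {ν : Basis ι ℚ K}
    {I T : FractionalIdeal (endOrder (Algebra.leftMulMatrix μ))⁰ K}
    {I' T' : FractionalIdeal (endOrder (Algebra.leftMulMatrix ν))⁰ K}
    (hI : (I : Set K) = (I' : Set K))
    (hT : (T : Submodule (endOrder (Algebra.leftMulMatrix μ)) K) =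
      traceDual ℤ ℚ (I : Submodule (endOrder (Algebra.leftMulMatrix μ)) K))
    (hT' : (T' : Submodule (endOrder (Algebra.leftMulMatrix ν)) K) =
      traceDual ℤ ℚ (I' : Submodule (endOrder (Algebra.leftMulMatrix ν)) K)) :
    (T : Set K) = (T' : Set K) := by
  have h1 := (coe_eq_traceDual_iff μ).1 hT
  have h2 := (coe_eq_traceDual_iff ν).1 hT'
  have h3 : (I : Submodule (endOrder (Algebra.leftMulMatrix μ)) K).restrictScalars ℤ =
      (I' : Submodule (endOrder (Algebra.leftMulMatrix ν)) K).restrictScalars ℤ :=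
    SetLike.ext' (by rw [Submodule.coe_restrictScalars, Submodule.coe_restrictScalars]; exact hI)
  rw [h3, ← h2] at h1
  have h4 := congr_arg (fun N : Submodule ℤ K ↦ (N : Set K)) h1
  simpa only [Submodule.coe_restrictScalars, coeToSet_coeToSubmodule] using h4

omit [Nonempty ι] [IsFractionRing (endOrder (Algebra.leftMulMatrix μ)) K] in
/-- **From the ring presentation to the base carrier: if the trace dual `Tᵗ` of `T = endOrder (M_ν) ⊇ S` is invertible
in `FractionalIdeal T⁰ K`, then the over-order `N` with `↑N = ↑T` satisfies `Nᵗ·B = N` for some fractional `S`-ideal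
`B`** (the inverse of `Tᵗ`, read as an `S`-ideal; products and trace duals are computed on lattices).
[cite: BuchmannLenstra1994, §2 Prop. 2.7 ((c) «`A†` is invertible»), p. 230] [cite: Marseglia2019, §2 Prop. 2.10 (c), p. 5] -/
theorem exists_traceDual_mul_eq_of_isUnit {ν : Basis ι ℚ K} {M : FractionalIdeal (endOrder (Algebra.leftMulMatrix μ))⁰ K}
    (hν : ∀ x : K, x ∈ endOrder (Algebra.leftMulMatrix ν) ↔ x ∈ M)
    (hST : endOrder (Algebra.leftMulMatrix μ) ≤ endOrder (Algebra.leftMulMatrix ν))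
    {T' : FractionalIdeal (endOrder (Algebra.leftMulMatrix ν))⁰ K}
    (hT' : (T' : Submodule (endOrder (Algebra.leftMulMatrix ν)) K) =
      traceDual ℤ ℚ ((1 : FractionalIdeal (endOrder (Algebra.leftMulMatrix ν))⁰ K) :
        Submodule (endOrder (Algebra.leftMulMatrix ν)) K))
    (hu : IsUnit T')
    {TM : FractionalIdeal (endOrder (Algebra.leftMulMatrix μ))⁰ K}
    (hTM : (TM : Submodule (endOrder (Algebra.leftMulMatrix μ)) K) =
      traceDual ℤ ℚ (M : Submodule (endOrder (Algebra.leftMulMatrix μ)) K)) :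
    ∃ B : FractionalIdeal (endOrder (Algebra.leftMulMatrix μ))⁰ K, TM * B = M := by
  obtain ⟨B', hB'⟩ := hu.exists_right_inv
  have hB'0 : B' ≠ 0 := fun h ↦ by
    rw [h, mul_zero] at hB'
    exact zero_ne_one hB'
  obtain ⟨B, -, hB⟩ := exists_coe_eq_overorderIdeal μ ν hST hB'0
  refine ⟨B, SetLike.coe_injective ?_⟩
  have h1 : ((1 : FractionalIdeal (endOrder (Algebra.leftMulMatrix ν))⁰ K) : Set K) = (M : Set K) := by
    rw [coe_one_eq_coe_endOrder ν]
    ext x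
    exact hν x
  have hTT : (TM : Set K) = (T' : Set K) := coe_eq_coe_of_coe_eq_traceDual μ h1.symm hTM hT'
  rw [coe_mul_eq_coe_mul_of_coe_eq μ ν hTT hB, hB', h1]

end Transport

/-! ## §2 PROPOSITION 4.6 (ii), (iii) and `ICM(S) = ⊔ Pic(T)` from «`𝒪_K/S` cyclic», on the base carrier -/

section BassBase

variable {K : Type} [Field K] [NumberField K]
variable {ι : Type} [Fintype ι] [DecidableEq ι] (μ : Basis ι ℚ K) [Nonempty ι]
variable [IsFractionRing (endOrder (Algebra.leftMulMatrix μ)) K]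

/-- **MARSEGLIA 2024 PROPOSITION 4.6, (iv) ⟹ (ii), base carrier: if `𝒪_K = S + Sω` then for every over-order
`N = NN ≠ 0` of `S` the trace dual `Nᵗ` is invertible in `N`: `Nᵗ·B = N`** (g29-#2's `isUnit_traceDual_of_le` for the
presentation `T = endOrder (M_ν)` of `N`, transported by §1). [cite: Marseglia2024CMType, §4 Prop. 4.6 ((iv) ⟹ (ii)),
p. 10] [cite: BuchmannLenstra1994, §2 Prop. 2.7 (c), p. 230] -/
theorem exists_traceDual_mul_eq_of_coe_eq_span_pair {M : FractionalIdeal (endOrder (Algebra.leftMulMatrix μ))⁰ K}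
    (hMO : (M : Set K) = (algebraMap (𝓞 K) K).range)
    {ω : K} (hcyc : (M : Submodule (endOrder (Algebra.leftMulMatrix μ)) K) =
      Submodule.span (endOrder (Algebra.leftMulMatrix μ)) {1, ω})
    {N : FractionalIdeal (endOrder (Algebra.leftMulMatrix μ))⁰ K} (hNN : N * N = N) (hN0 : N ≠ 0)
    {TN : FractionalIdeal (endOrder (Algebra.leftMulMatrix μ))⁰ K}
    (hTN : (TN : Submodule (endOrder (Algebra.leftMulMatrix μ)) K) =
      traceDual ℤ ℚ (N : Submodule (endOrder (Algebra.leftMulMatrix μ)) K)) :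
    ∃ B : FractionalIdeal (endOrder (Algebra.leftMulMatrix μ))⁰ K, TN * B = N := by
  obtain ⟨ν, hν, hST⟩ := exists_basis_mem_endOrder_iff_mem μ hNN hN0
  haveI := isFractionRing_endOrder (Algebra.leftMulMatrix ν)
  obtain ⟨T', -, hT'⟩ := exists_coe_eq_traceDual ν
    (one_ne_zero' (FractionalIdeal (endOrder (Algebra.leftMulMatrix ν))⁰ K))
  exact exists_traceDual_mul_eq_of_isUnit μ hν hST hT' (isUnit_traceDual_of_le μ hMO hcyc hST hT') hTN

/-- **MARSEGLIA 2024 PROPOSITION 4.6, (iv) ⟹ (ii) in Buchmann–Lenstra's form (a): if `𝒪_K = S + Sω` then every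
over-order `N = NN ≠ 0` is reflexive, `N:(N:I) = I` for every `N`-ideal `I ≠ 0`** (`CMOrderGorenstein`'s PROP. 2.7
(c) ⟹ (a)). [cite: Marseglia2024CMType, §4 Prop. 4.6 ((iv) ⟹ (ii)), p. 10] [cite: BuchmannLenstra1994, §2 Prop. 2.7
((c) ⟹ (a)), p. 230] [cite: Marseglia2019, §2 Prop. 2.10, p. 5] -/
theorem div_div_eq_of_coe_eq_span_pair {M : FractionalIdeal (endOrder (Algebra.leftMulMatrix μ))⁰ K}
    (hMO : (M : Set K) = (algebraMap (𝓞 K) K).range)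
    {ω : K} (hcyc : (M : Submodule (endOrder (Algebra.leftMulMatrix μ)) K) =
      Submodule.span (endOrder (Algebra.leftMulMatrix μ)) {1, ω})
    {N : FractionalIdeal (endOrder (Algebra.leftMulMatrix μ))⁰ K} (hN0 : N ≠ 0) (hNN : N * N = N)
    {I : FractionalIdeal (endOrder (Algebra.leftMulMatrix μ))⁰ K} (hI : I ≠ 0) (hNI : N * I = I) :
    N / (N / I) = I := by
  obtain ⟨TN, -, hTN⟩ := exists_coe_eq_traceDual μ hN0
  obtain ⟨B, hB⟩ := exists_traceDual_mul_eq_of_coe_eq_span_pair μ hMO hcyc hNN hN0 hTN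
  exact div_div_eq_of_traceDual_mul_eq μ hNN hN0 hTN hB hI hNI

/-- **MARSEGLIA 2024 PROPOSITION 4.6, (iv) ⟹ (iii), AS PRINTED on the base carrier: if `𝒪_K = S + Sω` then «every
fractional `S`-ideal `I` is invertible as a fractional `(I:I)`-ideal», `I·((I:I):I) = (I:I)` for every `I ≠ 0`**
(`CMOrderBassClifford`'s (a) ⟹ (b)). [cite: Marseglia2024CMType, §4 Prop. 4.6 ((iv) ⟹ (iii)), p. 10]
[cite: Marseglia2019, §3 Prop. 3.7 ((a) ⟹ (b)), p. 6] -/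
theorem mul_div_self_div_eq_div_self_of_coe_eq_span_pair
    {M : FractionalIdeal (endOrder (Algebra.leftMulMatrix μ))⁰ K}
    (hMO : (M : Set K) = (algebraMap (𝓞 K) K).range)
    {ω : K} (hcyc : (M : Submodule (endOrder (Algebra.leftMulMatrix μ)) K) =
      Submodule.span (endOrder (Algebra.leftMulMatrix μ)) {1, ω})
    {I : FractionalIdeal (endOrder (Algebra.leftMulMatrix μ))⁰ K} (hI : I ≠ 0) :
    I * (I / I / I) = I / I :=
  (forall_overorder_div_div_eq_iff_forall_mul_div_self_div_eq μ).1
    (fun _ hN0 hNN _ hJ hNJ ↦ div_div_eq_of_coe_eq_span_pair μ hMO hcyc hN0 hNN hJ hNJ) I hI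

/-- **`ICM(S) = ⊔_T Pic(T)` for an order with `𝒪_K = S + Sω`: every nonzero fractional ideal is invertible in an
over-order over which it is a module** (MARSEGLIA 2019 PROP. 3.7 (c) «`ICM(R)` is Clifford»; MARSEGLIA 2024 COR. 5.3
«The order `S` is Bass if and only if `ICM(S) = ⊔_T Pic(T)`»). [cite: Marseglia2019, §3 Prop. 3.7 ((b) ⟹ (c)), p. 6]
[cite: Marseglia2024CMType, §5 Cor. 5.3, p. 13; §4 Prop. 4.6, p. 10] -/
theorem exists_idempotent_invertible_of_coe_eq_span_pair
    {M : FractionalIdeal (endOrder (Algebra.leftMulMatrix μ))⁰ K}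
    (hMO : (M : Set K) = (algebraMap (𝓞 K) K).range)
    {ω : K} (hcyc : (M : Submodule (endOrder (Algebra.leftMulMatrix μ)) K) =
      Submodule.span (endOrder (Algebra.leftMulMatrix μ)) {1, ω})
    {I : FractionalIdeal (endOrder (Algebra.leftMulMatrix μ))⁰ K} (hI : I ≠ 0) :
    ∃ N J : FractionalIdeal (endOrder (Algebra.leftMulMatrix μ))⁰ K, N ≠ 0 ∧ N * N = N ∧ N * I = I ∧ I * J = N :=
  (forall_mul_div_self_div_eq_iff_forall_exists_idempotent_invertible μ).1
    (fun _ hJ ↦ mul_div_self_div_eq_div_self_of_coe_eq_span_pair μ hMO hcyc hJ) I hI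

/-- **… with the canonical inverse: `Nᵗ·(N:Nᵗ) = N` for every over-order `N` of an order with `𝒪_K = S + Sω`**
(PROP. 2.7 (a) ⟹ (c) of `CMOrderGorenstein`). [cite: BuchmannLenstra1994, §2 Prop. 2.7 ((a) ⟺ (c)), p. 230]
[cite: Marseglia2024CMType, §4 Prop. 4.6 ((iv) ⟹ (ii)), p. 10] -/
theorem traceDual_mul_div_eq_of_coe_eq_span_pair {M : FractionalIdeal (endOrder (Algebra.leftMulMatrix μ))⁰ K}
    (hMO : (M : Set K) = (algebraMap (𝓞 K) K).range)
    {ω : K} (hcyc : (M : Submodule (endOrder (Algebra.leftMulMatrix μ)) K) =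
      Submodule.span (endOrder (Algebra.leftMulMatrix μ)) {1, ω})
    {N : FractionalIdeal (endOrder (Algebra.leftMulMatrix μ))⁰ K} (hNN : N * N = N) (hN0 : N ≠ 0)
    {TN : FractionalIdeal (endOrder (Algebra.leftMulMatrix μ))⁰ K} (hTN0 : TN ≠ 0)
    (hTN : (TN : Submodule (endOrder (Algebra.leftMulMatrix μ)) K) =
      traceDual ℤ ℚ (N : Submodule (endOrder (Algebra.leftMulMatrix μ)) K)) :
    TN * (N / TN) = N :=
  (forall_div_div_eq_iff_traceDual_mul_div_eq μ hNN hN0 hTN0 hTN).1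
    fun _ hI hNI ↦ div_div_eq_of_coe_eq_span_pair μ hMO hcyc hN0 hNN hI hNI

/-- **An order with `𝒪_K = S + Sω` is Gorenstein: its trace dual `Sᵗ` is an invertible fractional ideal** (the case
`T = S` of g29-#2's `isUnit_traceDual_of_le`; PROP. 3.4 (3)). [cite: Marseglia2024CMType, §4 Prop. 4.6 ((iv) ⟹ (ii)) and
§3 Prop. 3.4, pp. 9–10] [cite: Greither1982TwoGenerator, §2 Thm. 2.3 ((a) ⟹ (e)), p. 268] -/
theorem isUnit_traceDual_one_of_coe_eq_span_pair {M : FractionalIdeal (endOrder (Algebra.leftMulMatrix μ))⁰ K}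
    (hMO : (M : Set K) = (algebraMap (𝓞 K) K).range)
    {ω : K} (hcyc : (M : Submodule (endOrder (Algebra.leftMulMatrix μ)) K) =
      Submodule.span (endOrder (Algebra.leftMulMatrix μ)) {1, ω})
    {T : FractionalIdeal (endOrder (Algebra.leftMulMatrix μ))⁰ K}
    (hT : (T : Submodule (endOrder (Algebra.leftMulMatrix μ)) K) =
      traceDual ℤ ℚ ((1 : FractionalIdeal (endOrder (Algebra.leftMulMatrix μ))⁰ K) :
        Submodule (endOrder (Algebra.leftMulMatrix μ)) K)) :
    IsUnit T :=
  isUnit_traceDual_of_le μ hMO hcyc le_rfl hT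

/-- **… hence every fractional `S`-ideal `I ≠ 0` with `(I:I) = S` is invertible** (PROP. 3.4 (4)).
[cite: Marseglia2024CMType, §3 Prop. 3.4 and §4 Prop. 4.6, pp. 9–10] -/
theorem isUnit_of_div_self_eq_one_of_coe_eq_span_pair {M : FractionalIdeal (endOrder (Algebra.leftMulMatrix μ))⁰ K}
    (hMO : (M : Set K) = (algebraMap (𝓞 K) K).range)
    {ω : K} (hcyc : (M : Submodule (endOrder (Algebra.leftMulMatrix μ)) K) =
      Submodule.span (endOrder (Algebra.leftMulMatrix μ)) {1, ω})
    {I : FractionalIdeal (endOrder (Algebra.leftMulMatrix μ))⁰ K} (hI : I ≠ 0) (hII : I / I = 1) : IsUnit I :=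
  isUnit_of_div_self_eq_one_of_le μ hMO hcyc le_rfl hI hII

end BassBase

/-! ## §3 CM tori over a Bass order: each over-order stratum has `#ClassGroup T` classes -/

section BassCount

open Literature.AlgebraicGeometry.Motives (CMType)
open Literature.AlgebraicGeometry.ComplexMultiplication (CMTorus.periodEquiv)
open Literature.Geometry.Kaehler
open Literature.Geometry.Kaehler.ComplexTorus (mapMatrix)

variable {K : Type} [Field K] [NumberField K]
variable {ι : Type} [Fintype ι] [DecidableEq ι] (μ : Basis ι ℚ K) [Nonempty ι]
variable [IsFractionRing (endOrder (Algebra.leftMulMatrix μ)) K]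

open scoped Classical in
/-- **CM tori over a Bass order, stratum by stratum: if `𝒪_K = S + Sω` then for EVERY over-order
`T = endOrder (M_ν) ⊇ S` the CM tori of type `(K, Φ)` with multiplication by `S` and endomorphism order exactly `T`
fall into `#ClassGroup T` `K`-isomorphism classes** — «`S` is Bass iff `ICM(S) = ⊔_T Pic(T)`» read on CM tori
(`CMOrderOverorderPicardClasses`' count `= #ClassGroup T ⟺` BUCHMANN–LENSTRA (a) for `T`, and (a) holds for every
over-order of a Bass order, §2). [cite: Marseglia2024CMType, §5 Cor. 5.3, p. 13; §4 Prop. 4.6, p. 10]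
[cite: Marseglia2019, §3 Prop. 3.7 and §4 Thm. 4.6, pp. 6, 9] [cite: Shimura1998, §7.4 Prop. 17, p. 58] -/
theorem natCard_quot_exists_bijective_comm_eq_natCard_classGroup_of_coe_eq_span_pair (Φ : CMType K)
    {M : FractionalIdeal (endOrder (Algebra.leftMulMatrix μ))⁰ K}
    (hMO : (M : Set K) = (algebraMap (𝓞 K) K).range)
    {ω : K} (hcyc : (M : Submodule (endOrder (Algebra.leftMulMatrix μ)) K) =
      Submodule.span (endOrder (Algebra.leftMulMatrix μ)) {1, ω})
    {ν : Basis ι ℚ K} (hle : endOrder (Algebra.leftMulMatrix μ) ≤ endOrder (Algebra.leftMulMatrix ν)) :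
    Nat.card (Quot fun μ' μ'' : {μ' : Basis ι ℚ K //
        endOrder (Algebra.leftMulMatrix μ) ≤ endOrder (Algebra.leftMulMatrix μ') ∧
          endOrder (Algebra.leftMulMatrix μ') = endOrder (Algebra.leftMulMatrix ν)} =>
      ∃ A : Matrix ι ι ℤ,
        Function.Bijective
            (mapMatrix (CMTorus.periodEquiv Φ (μ' : Basis ι ℚ K)) (CMTorus.periodEquiv Φ (μ'' : Basis ι ℚ K)) A) ∧
          ∀ α : K, A.map (Int.cast : ℤ → ℚ) * Algebra.leftMulMatrix (μ' : Basis ι ℚ K) α =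
            Algebra.leftMulMatrix (μ'' : Basis ι ℚ K) α * A.map (Int.cast : ℤ → ℚ)) =
      Nat.card (ClassGroup (endOrder (Algebra.leftMulMatrix ν))) := by
  obtain ⟨N, hN0, hNN, hNS⟩ := exists_idempotent_coe_eq_endOrder μ ν hle
  exact (natCard_quot_exists_bijective_comm_eq_natCard_classGroup_iff_forall_div_div_eq μ ν Φ hle hNN hN0 hNS).2
    fun I hI hNI ↦ div_div_eq_of_coe_eq_span_pair μ hMO hcyc hN0 hNN hI hNI

end BassCount

end CMTypeLattice

end Literature.NumberTheory.ComplexMultiplication
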